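import Summits.QuantumFields.YangMills.Theorems.BalabanUVNodesN19LacunaryCosineSums

/-!
# N19 (NE7, s3 ALTERNATIVE CURRENCY) — Base-8 lacunary dissociation and the Riesz-product orthogonality relations on `[0,π]`

Module 100 of the `dag-n19-e` lineage (CURRENCY-MAP v4 open item (y): the law-summability threshold of the WINDOW
currency for ARBITRARY positive remainders).  The arithmetic and trigonometric engine of the RIESZ-PRODUCT LAWS of
module 101: the densities `ρ_A(φ) = ∏_{e∈A}(1 + cos(ν_eφ))` on `[0,π]` at the lacunary frequencies `ν_e = 8^{e+1}`.

* §1 BASE-8 DISSOCIATIVITY [folklore]: a signed sum `Σ_{k∈S} ε_k 8^{k+1}` (`ε_k = ±1`, `S` nonempty with top index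
  `m`) satisfies `6·8^{m+1} + 8 ≤ 7|Σ| ≤ 8^{m+2} − 8`; hence `|Σ| ≥ 8`, `|Σ| ≠ 2·8^{e+1} + d` for `e ∉ S`, `|d| ≤ 2`,
  and `|Σ| > 6·8^e + 1` whenever `e ∈ S`.
* §2 ORTHOGONALITY [folklore]: by module 93 (`integral_prod_cos_mul_cos_eq_zero`: a product of cosines integrates to
  zero against every non-resonant frequency) — (a) `∫_0^π cos^jφ·cos(μφ)·∏_{k∈T}cos(8^{k+1}φ)dφ = 0` as long as
  `j + |μ|` stays below the dissociation bound of `T` (induction on `j`, `2cos a cos b = cos(a−b) + cos(a+b)`);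
  (b) `∫_0^π ρ_A = π`; (c) TOGGLING a level `e ∉ A` is invisible to the moments `j ≤ 6·8^e`:
  `∫_0^π cos^jφ·cos(8^{e+1}φ)·ρ_A(φ)dφ = 0`; (d) and is paid by `sin²φ·cos(8^{e+1}φ)` exactly:
  `∫_0^π sin²φ·cos²(8^{e+1}φ)·ρ_A(φ)dφ = π∕4`.

HONEST FRAMING: [folklore] arithmetic and calculus over Mathlib and module 93 BY NAME; no law, no scheme object, no
consumer in the DAG today; nothing of Bałaban's is instantiated; NE7 is NOT PRINTED and NOT proved here; N19 is NOT
discharged; count-neutral.  One finite 𝕋⁴ programme at fixed ε; nothing continuum ∕ OS ∕ mass-gap ∕ Clay.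
-/

open Real Finset MeasureTheory

namespace Summit.QuantumFields.YangMills.Theorems.BalabanUVNodesN19OctalLacunaryDissociation

open BalabanUVNodesN19LacunaryCosineSums

/-! ## §1 Base-8 dissociativity [folklore] -/

/-- `7·Σ_{k<K} 8^{k+1} = 8^{K+1} − 8`. [bookkeeping] -/
theorem seven_mul_sum_pow_eight (K : ℕ) :
    7 * ∑ k ∈ range K, (8 : ℤ) ^ (k + 1) = 8 ^ (K + 1) - 8 := by
  induction K with
  | zero => simp
  | succ K ih => rw [Finset.sum_range_succ, mul_add, ih]; ring

/-- Below the top index: for `S ⊆ {0,…,K−1}` and `|ε_k| ≤ 1`, `7·|Σ_{k∈S} ε_k 8^{k+1}| ≤ 8^{K+1} − 8`. [folklore] -/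
theorem abs_octSum_le {S : Finset ℕ} {K : ℕ} (hS : S ⊆ range K) (ε : ℕ → ℤ) (hε : ∀ k ∈ S, |ε k| ≤ 1) :
    7 * |∑ k ∈ S, ε k * (8 : ℤ) ^ (k + 1)| ≤ 8 ^ (K + 1) - 8 := by
  have h1 : |∑ k ∈ S, ε k * (8 : ℤ) ^ (k + 1)| ≤ ∑ k ∈ S, (8 : ℤ) ^ (k + 1) := by
    refine (Finset.abs_sum_le_sum_abs _ _).trans (Finset.sum_le_sum fun k hk => ?_)
    rw [abs_mul, abs_of_pos (by positivity : (0 : ℤ) < 8 ^ (k + 1))]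
    calc |ε k| * (8 : ℤ) ^ (k + 1) ≤ 1 * 8 ^ (k + 1) := mul_le_mul_of_nonneg_right (hε k hk) (by positivity)
      _ = _ := one_mul _
  have h2 : ∑ k ∈ S, (8 : ℤ) ^ (k + 1) ≤ ∑ k ∈ range K, (8 : ℤ) ^ (k + 1) :=
    Finset.sum_le_sum_of_subset_of_nonneg hS fun k _ _ => by positivity
  have h3 := seven_mul_sum_pow_eight K
  nlinarith [abs_nonneg (∑ k ∈ S, ε k * (8 : ℤ) ^ (k + 1))]

/-- ★ THE TOP TERM DOMINATES: for a nonempty `S` with top index `m` and signs `ε_k = ±1`,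
`6·8^{m+1} + 8 ≤ 7·|Σ_{k∈S} ε_k 8^{k+1}| ≤ 8^{m+2} − 8`. [folklore] -/
theorem abs_octSum_bounds {S : Finset ℕ} (hne : S.Nonempty) (ε : ℕ → ℤ) (hε : ∀ k ∈ S, ε k = 1 ∨ ε k = -1) :
    6 * 8 ^ (S.max' hne + 1) + 8 ≤ 7 * |∑ k ∈ S, ε k * (8 : ℤ) ^ (k + 1)| ∧
    7 * |∑ k ∈ S, ε k * (8 : ℤ) ^ (k + 1)| ≤ 8 ^ (S.max' hne + 2) - 8 := by
  classical
  set m := S.max' hne with hm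
  have hmem : m ∈ S := Finset.max'_mem S hne
  have hsplit : ∑ k ∈ S, ε k * (8 : ℤ) ^ (k + 1) =
      ε m * 8 ^ (m + 1) + ∑ k ∈ S.erase m, ε k * (8 : ℤ) ^ (k + 1) :=
    (Finset.add_sum_erase S (fun k => ε k * (8 : ℤ) ^ (k + 1)) hmem).symm
  have hsub : S.erase m ⊆ range m := by
    intro k hk
    rw [Finset.mem_erase] at hk
    exact Finset.mem_range.2 (lt_of_le_of_ne (Finset.le_max' S k hk.2) hk.1)
  have hrest := abs_octSum_le hsub ε fun k hk => by
    rcases hε k (Finset.mem_of_mem_erase hk) with h | h <;> simp [h]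
  set T' := ∑ k ∈ S.erase m, ε k * (8 : ℤ) ^ (k + 1) with hT'
  have h8 : (8 : ℤ) ^ (m + 2) = 8 * 8 ^ (m + 1) := by ring
  rw [hsplit, h8]
  rcases hε m hmem with h | h
  · rw [h, one_mul]
    have h1 := abs_add_le ((8 : ℤ) ^ (m + 1)) T'
    have h2 := abs_sub_abs_le_abs_add ((8 : ℤ) ^ (m + 1)) T'
    rw [abs_of_pos (by positivity : (0 : ℤ) < 8 ^ (m + 1))] at h1 h2
    constructor <;> nlinarith [h1, h2, hrest]
  · rw [h, neg_one_mul]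
    have h1 := abs_add_le (-(8 : ℤ) ^ (m + 1)) T'
    have h2 := abs_sub_abs_le_abs_add (-(8 : ℤ) ^ (m + 1)) T'
    rw [abs_neg, abs_of_pos (by positivity : (0 : ℤ) < 8 ^ (m + 1))] at h1 h2
    constructor <;> nlinarith [h1, h2, hrest]

/-- A nonempty signed sum is at least `8` in absolute value. [folklore] -/
theorem eight_le_abs_octSum {S : Finset ℕ} (hne : S.Nonempty) (ε : ℕ → ℤ) (hε : ∀ k ∈ S, ε k = 1 ∨ ε k = -1) :
    8 ≤ |∑ k ∈ S, ε k * (8 : ℤ) ^ (k + 1)| := by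
  obtain ⟨h1, -⟩ := abs_octSum_bounds hne ε hε
  have h8 : (8 : ℤ) ≤ 8 ^ (S.max' hne + 1) := by
    calc (8 : ℤ) = 8 ^ 1 := by norm_num
      _ ≤ 8 ^ (S.max' hne + 1) := pow_le_pow_right₀ (by norm_num) (by omega)
  nlinarith

/-- ★ DISSOCIATIVITY AGAINST THE DOUBLED FREQUENCY OF AN ABSENT LEVEL: if `e ∉ S` (nonempty) then
`|Σ_{k∈S} ε_k 8^{k+1}| ≠ 2·8^{e+1} + d` for every `|d| ≤ 2`. [folklore] -/
theorem abs_octSum_ne_double {S : Finset ℕ} (hne : S.Nonempty) (ε : ℕ → ℤ) (hε : ∀ k ∈ S, ε k = 1 ∨ ε k = -1)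
    {e : ℕ} (he : e ∉ S) {d : ℤ} (hd : |d| ≤ 2) :
    |∑ k ∈ S, ε k * (8 : ℤ) ^ (k + 1)| ≠ 2 * 8 ^ (e + 1) + d := by
  obtain ⟨h1, h2⟩ := abs_octSum_bounds hne ε hε
  set m := S.max' hne with hm
  have hme : m ≠ e := fun h => he (h ▸ Finset.max'_mem S hne)
  have hd' := abs_le.1 hd
  intro habs
  rw [habs] at h1 h2
  have h8 : (8 : ℤ) ≤ 8 ^ (e + 1) := by
    calc (8 : ℤ) = 8 ^ 1 := by norm_num
      _ ≤ 8 ^ (e + 1) := pow_le_pow_right₀ (by norm_num) (by omega)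
  rcases lt_or_gt_of_ne hme with hlt | hgt
  · -- `m + 1 ≤ e`: the sum is too small
    have : (8 : ℤ) ^ (m + 2) ≤ 8 ^ (e + 1) := pow_le_pow_right₀ (by norm_num) (by omega)
    linarith
  · -- `e + 1 ≤ m`: the sum is too large
    have : (8 : ℤ) ^ (e + 1) * 8 ≤ 8 ^ (m + 1) := by
      rw [← pow_succ]; exact pow_le_pow_right₀ (by norm_num) (by omega)
    linarith

/-- ★ A PRESENT LEVEL DOMINATES: if `e ∈ T` then `6·8^e + 1 < |Σ_{k∈T} ε_k 8^{k+1}|`. [folklore] -/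
theorem lt_abs_octSum_of_mem {T : Finset ℕ} (ε : ℕ → ℤ) (hε : ∀ k ∈ T, ε k = 1 ∨ ε k = -1) {e : ℕ} (he : e ∈ T) :
    (6 * 8 ^ e + 1 : ℤ) < |∑ k ∈ T, ε k * (8 : ℤ) ^ (k + 1)| := by
  have hne : T.Nonempty := ⟨e, he⟩
  obtain ⟨h1, -⟩ := abs_octSum_bounds hne ε hε
  have hem : e ≤ T.max' hne := Finset.le_max' T e he
  have : (8 : ℤ) ^ (e + 1) ≤ 8 ^ (T.max' hne + 1) := pow_le_pow_right₀ (by norm_num) (by omega)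
  have h8 : (8 : ℤ) ^ (e + 1) = 8 * 8 ^ e := by ring
  have h0 : (0 : ℤ) < 8 ^ e := by positivity
  nlinarith

/-- From `|a| ≠ b` with `b ≥ 0`: `a ≠ b` and `a ≠ −b`. [bookkeeping] -/
theorem ne_and_ne_neg_of_abs_ne {a b : ℤ} (hb : 0 ≤ b) (h : |a| ≠ b) : a ≠ b ∧ a ≠ -b := by
  constructor
  · rintro rfl; exact h (abs_of_nonneg hb)
  · rintro rfl; exact h (by rw [abs_neg, abs_of_nonneg hb])

/-! ## §2 Orthogonality relations on `[0,π]` [folklore] -/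

/-- Casting bridge: the integer frequency `8^{k+1}` as a real number. [bookkeeping] -/
theorem cast_octFreq (k : ℕ) : (((8 : ℤ) ^ (k + 1) : ℤ) : ℝ) = (8 : ℝ) ^ (k + 1) := by push_cast; ring

/-- Continuity of `cos^j·cos(μ·)·∏cos(8^{k+1}·)`. [bookkeeping] -/
theorem continuous_cos_pow_mul_cos_mul_prodCos (T : Finset ℕ) (j : ℕ) (μ : ℝ) :
    Continuous fun φ : ℝ => Real.cos φ ^ j * Real.cos (μ * φ) * ∏ k ∈ T, Real.cos ((8 : ℝ) ^ (k + 1) * φ) :=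
  ((Real.continuous_cos.pow j).mul (Real.continuous_cos.comp (continuous_const.mul continuous_id))).mul
    (continuous_finsetProd _ fun _ _ => Real.continuous_cos.comp (continuous_const.mul continuous_id))

/-- Module 93's non-resonance lemma at the octal frequencies, real form: if no choice of signs gives
`Σ_{k∈T} ε_k 8^{k+1} = ±μ` then `∫_0^π cos(μφ)·∏_{k∈T}cos(8^{k+1}φ)dφ = 0`. [folklore] -/
theorem integral_cos_mul_prodCos_eq_zero (T : Finset ℕ) (μ : ℤ)
    (h : ∀ ε : ℕ → ℤ, (∀ k ∈ T, ε k = 1 ∨ ε k = -1) →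
      (∑ k ∈ T, ε k * (8 : ℤ) ^ (k + 1)) ≠ μ ∧ (∑ k ∈ T, ε k * (8 : ℤ) ^ (k + 1)) ≠ -μ) :
    ∫ φ in (0 : ℝ)..π, Real.cos (μ * φ) * ∏ k ∈ T, Real.cos ((8 : ℝ) ^ (k + 1) * φ) = 0 := by
  have h93 := integral_prod_cos_mul_cos_eq_zero (fun k => (8 : ℤ) ^ (k + 1)) T μ h
  push_cast at h93
  refine Eq.trans (intervalIntegral.integral_congr fun φ _ => ?_) h93
  exact mul_comm _ _

/-- ★ (a) ORTHOGONALITY BELOW THE DISSOCIATION BOUND: if every signed sum over `T` exceeds `M` in absolute value,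
then `∫_0^π cos^jφ·cos(μφ)·∏_{k∈T}cos(8^{k+1}φ)dφ = 0` whenever `j + |μ| < M` (induction on `j` with
`2cos(μφ)cos φ = cos((μ−1)φ) + cos((μ+1)φ)`). [folklore] -/
theorem integral_cos_pow_mul_cos_mul_prodCos_eq_zero (T : Finset ℕ) (M : ℕ)
    (hM : ∀ ε : ℕ → ℤ, (∀ k ∈ T, ε k = 1 ∨ ε k = -1) → (M : ℤ) < |∑ k ∈ T, ε k * (8 : ℤ) ^ (k + 1)|)
    {j : ℕ} {μ : ℤ} (hj : (j : ℤ) + |μ| < M) :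
    ∫ φ in (0 : ℝ)..π, Real.cos φ ^ j * Real.cos (μ * φ) * ∏ k ∈ T, Real.cos ((8 : ℝ) ^ (k + 1) * φ) = 0 := by
  induction j generalizing μ with
  | zero =>
    simp only [pow_zero, one_mul]
    refine integral_cos_mul_prodCos_eq_zero T μ fun ε hε => ?_
    have h1 := hM ε hε
    push_cast at hj
    constructor
    · intro h; rw [h] at h1; linarith
    · intro h; rw [h, abs_neg] at h1; linarith
  | succ j ih =>
    have e : ∀ φ : ℝ, Real.cos φ ^ (j + 1) * Real.cos (μ * φ) * ∏ k ∈ T, Real.cos ((8 : ℝ) ^ (k + 1) * φ) =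
        (1 / 2 : ℝ) * (Real.cos φ ^ j * Real.cos (((μ - 1 : ℤ) : ℝ) * φ) * ∏ k ∈ T, Real.cos ((8 : ℝ) ^ (k + 1) * φ)) +
        (1 / 2 : ℝ) * (Real.cos φ ^ j * Real.cos (((μ + 1 : ℤ) : ℝ) * φ) * ∏ k ∈ T, Real.cos ((8 : ℝ) ^ (k + 1) * φ)) := by
      intro φ
      have h2 := Real.two_mul_cos_mul_cos (μ * φ) φ
      have e1 : ((μ - 1 : ℤ) : ℝ) * φ = μ * φ - φ := by push_cast; ring
      have e2 : ((μ + 1 : ℤ) : ℝ) * φ = μ * φ + φ := by push_cast; ring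
      rw [e1, e2, pow_succ]
      linear_combination (1 / 2 : ℝ) * Real.cos φ ^ j * (∏ k ∈ T, Real.cos ((8 : ℝ) ^ (k + 1) * φ)) * h2
    simp_rw [e]
    have hc := fun ν : ℤ => continuous_cos_pow_mul_cos_mul_prodCos T j (ν : ℝ)
    rw [intervalIntegral.integral_add (((hc (μ - 1)).intervalIntegrable 0 π).const_mul (1 / 2 : ℝ))
      (((hc (μ + 1)).intervalIntegrable 0 π).const_mul (1 / 2 : ℝ)), intervalIntegral.integral_const_mul,
      intervalIntegral.integral_const_mul, ih, ih]
    · ring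
    · push_cast at hj ⊢
      have := abs_add_le μ 1
      simp only [abs_one] at this
      linarith
    · push_cast at hj ⊢
      have := abs_sub μ 1
      simp only [abs_one] at this
      linarith

/-- (b) A NONEMPTY PRODUCT OF OCTAL COSINES INTEGRATES TO ZERO on `[0,π]`. [folklore] -/
theorem integral_prodCos_eq_zero {S : Finset ℕ} (hne : S.Nonempty) :
    ∫ φ in (0 : ℝ)..π, ∏ k ∈ S, Real.cos ((8 : ℝ) ^ (k + 1) * φ) = 0 := by
  have h := integral_cos_mul_prodCos_eq_zero S 0 fun ε hε => by
    have h8 := eight_le_abs_octSum hne ε hε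
    constructor <;> (intro h0; rw [h0] at h8; norm_num at h8)
  simpa using h

/-- ★ (b′) THE RIESZ DENSITY HAS MASS `π`: `∫_0^π ∏_{e∈A}(1 + cos(8^{e+1}φ))dφ = π` (expand over subsets; only
the empty product survives). [folklore] -/
theorem integral_rieszDensity (A : Finset ℕ) :
    ∫ φ in (0 : ℝ)..π, ∏ e ∈ A, (1 + Real.cos ((8 : ℝ) ^ (e + 1) * φ)) = π := by
  classical
  simp_rw [Finset.prod_one_add]
  have hint : ∀ S ∈ A.powerset, IntervalIntegrable
      (fun φ : ℝ => ∏ k ∈ S, Real.cos ((8 : ℝ) ^ (k + 1) * φ)) volume 0 π := fun S _ =>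
    (continuous_finsetProd _ fun _ _ =>
      Real.continuous_cos.comp (continuous_const.mul continuous_id)).intervalIntegrable _ _
  rw [intervalIntegral.integral_finsetSum hint, Finset.sum_eq_single_of_mem ∅ (Finset.empty_mem_powerset A)]
  · simp
  · intro S _ hS
    exact integral_prodCos_eq_zero (Finset.nonempty_iff_ne_empty.2 hS)

/-- The Riesz density is nonnegative. [bookkeeping] -/
theorem rieszDensity_nonneg (A : Finset ℕ) (φ : ℝ) :
    0 ≤ ∏ e ∈ A, (1 + Real.cos ((8 : ℝ) ^ (e + 1) * φ)) :=
  Finset.prod_nonneg fun e _ => by linarith [Real.neg_one_le_cos ((8 : ℝ) ^ (e + 1) * φ)]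

/-- Continuity of the Riesz density. [bookkeeping] -/
theorem continuous_rieszDensity (A : Finset ℕ) :
    Continuous fun φ : ℝ => ∏ e ∈ A, (1 + Real.cos ((8 : ℝ) ^ (e + 1) * φ)) :=
  continuous_finsetProd _ fun _ _ => continuous_const.add (Real.continuous_cos.comp (continuous_const.mul continuous_id))

/-- (c) TOGGLING AN ABSENT LEVEL IS INVISIBLE BELOW ITS DISSOCIATION BOUND, product form: for `e ∉ S` and
`j ≤ 6·8^e`, `∫_0^π cos^jφ·cos(8^{e+1}φ)·∏_{k∈S}cos(8^{k+1}φ)dφ = 0`. [folklore] -/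
theorem integral_cos_pow_mul_cosOct_mul_prodCos_eq_zero {S : Finset ℕ} {e j : ℕ} (he : e ∉ S) (hj : j ≤ 6 * 8 ^ e) :
    ∫ φ in (0 : ℝ)..π, Real.cos φ ^ j * Real.cos ((8 : ℝ) ^ (e + 1) * φ) * ∏ k ∈ S, Real.cos ((8 : ℝ) ^ (k + 1) * φ) = 0 := by
  classical
  have h := integral_cos_pow_mul_cos_mul_prodCos_eq_zero (insert e S) (6 * 8 ^ e + 1)
    (fun ε hε => by exact_mod_cast lt_abs_octSum_of_mem ε hε (Finset.mem_insert_self e S)) (j := j) (μ := 0)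
    (by push_cast; simp only [abs_zero, add_zero]; exact_mod_cast Nat.lt_succ_of_le hj)
  refine Eq.trans (intervalIntegral.integral_congr fun φ _ => ?_) h
  simp only [Finset.prod_insert he, Int.cast_zero, zero_mul, Real.cos_zero, mul_one]
  ring

/-- ★ (c′) TOGGLING A LEVEL `e ∉ A` DOES NOT MOVE THE MOMENTS `j ≤ 6·8^e`:
`∫_0^π cos^jφ·cos(8^{e+1}φ)·ρ_A(φ)dφ = 0`. [folklore] -/
theorem integral_cos_pow_mul_cosOct_mul_rieszDensity_eq_zero {A : Finset ℕ} {e j : ℕ} (he : e ∉ A)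
    (hj : j ≤ 6 * 8 ^ e) :
    ∫ φ in (0 : ℝ)..π, Real.cos φ ^ j * Real.cos ((8 : ℝ) ^ (e + 1) * φ) *
      ∏ k ∈ A, (1 + Real.cos ((8 : ℝ) ^ (k + 1) * φ)) = 0 := by
  classical
  simp_rw [Finset.prod_one_add, Finset.mul_sum]
  have hint : ∀ S ∈ A.powerset, IntervalIntegrable (fun φ : ℝ => Real.cos φ ^ j * Real.cos ((8 : ℝ) ^ (e + 1) * φ) *
      ∏ k ∈ S, Real.cos ((8 : ℝ) ^ (k + 1) * φ)) volume 0 π := fun S _ =>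
    (continuous_cos_pow_mul_cos_mul_prodCos S j _).intervalIntegrable _ _
  rw [intervalIntegral.integral_finsetSum hint]
  refine Finset.sum_eq_zero fun S hS => ?_
  exact integral_cos_pow_mul_cosOct_mul_prodCos_eq_zero (fun h => he (Finset.mem_powerset.1 hS h)) hj

/-- The five frequencies of `sin²φ·cos²(νφ)`:
`sin²φ·cos²(νφ) = ¼ − ¼cos(2φ) + ¼cos(2νφ) − ⅛cos((2ν−2)φ) − ⅛cos((2ν+2)φ)`. [bookkeeping] -/
theorem sin_sq_mul_cos_sq_eq (ν φ : ℝ) :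
    Real.sin φ ^ 2 * Real.cos (ν * φ) ^ 2 =
      1 / 4 - 1 / 4 * Real.cos (2 * φ) + 1 / 4 * Real.cos (2 * ν * φ) -
        1 / 8 * Real.cos ((2 * ν - 2) * φ) - 1 / 8 * Real.cos ((2 * ν + 2) * φ) := by
  have h1 : Real.sin φ ^ 2 = 1 / 2 - Real.cos (2 * φ) / 2 := by
    rw [Real.cos_two_mul, Real.cos_sq']; ring
  have h2 : Real.cos (ν * φ) ^ 2 = 1 / 2 + Real.cos (2 * ν * φ) / 2 := by
    rw [Real.cos_sq (ν * φ)]; ring_nf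
  have h3 := Real.two_mul_cos_mul_cos (2 * ν * φ) (2 * φ)
  have e1 : (2 * ν - 2) * φ = 2 * ν * φ - 2 * φ := by ring
  have e2 : (2 * ν + 2) * φ = 2 * ν * φ + 2 * φ := by ring
  rw [h1, h2, e1, e2]
  linear_combination (-1 / 8 : ℝ) * h3

/-- (d) THE PAYMENT INTEGRAL, product form: for `e ∉ S`,
`∫_0^π sin²φ·cos²(8^{e+1}φ)·∏_{k∈S}cos(8^{k+1}φ)dφ` is `π∕4` if `S = ∅` and `0` otherwise. [folklore] -/
theorem integral_sin_sq_mul_cosOct_sq_mul_prodCos {S : Finset ℕ} {e : ℕ} (he : e ∉ S) :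
    ∫ φ in (0 : ℝ)..π, Real.sin φ ^ 2 * Real.cos ((8 : ℝ) ^ (e + 1) * φ) ^ 2 *
      ∏ k ∈ S, Real.cos ((8 : ℝ) ^ (k + 1) * φ) = if S = ∅ then π / 4 else 0 := by
  classical
  set P : ℝ → ℝ := fun φ => ∏ k ∈ S, Real.cos ((8 : ℝ) ^ (k + 1) * φ) with hP
  have hPc : Continuous P := continuous_finsetProd _ fun _ _ => Real.continuous_cos.comp (continuous_const.mul continuous_id)
  have hI : ∀ a : ℝ, IntervalIntegrable (fun φ : ℝ => Real.cos (a * φ) * P φ) volume 0 π := fun a =>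
    ((Real.continuous_cos.comp (continuous_const.mul continuous_id)).mul hPc).intervalIntegrable _ _
  have hIP : IntervalIntegrable P volume 0 π := hPc.intervalIntegrable _ _
  have h8 : (8 : ℤ) ≤ 8 ^ (e + 1) := by
    calc (8 : ℤ) = 8 ^ 1 := by norm_num
      _ ≤ 8 ^ (e + 1) := pow_le_pow_right₀ (by norm_num) (by omega)
  -- the four oscillating frequencies integrate to zero against `P`, the constant one to `π` or `0`
  have hfreq : ∀ d : ℤ, |d| ≤ 2 → ∫ φ in (0 : ℝ)..π, Real.cos (((2 * 8 ^ (e + 1) + d : ℤ) : ℝ) * φ) * P φ = 0 := by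
    intro d hd
    have hd' := abs_le.1 hd
    rcases S.eq_empty_or_nonempty with hS | hS
    · simp only [hP, hS, Finset.prod_empty, mul_one]
      exact integral_cos_int_mul (by omega)
    · exact integral_cos_mul_prodCos_eq_zero S _ fun ε hε =>
        ne_and_ne_neg_of_abs_ne (by omega) (abs_octSum_ne_double hS ε hε he hd)
  have htwo : ∫ φ in (0 : ℝ)..π, Real.cos (((2 : ℤ) : ℝ) * φ) * P φ = 0 := by
    rcases S.eq_empty_or_nonempty with hS | hS
    · simp only [hP, hS, Finset.prod_empty, mul_one]
      exact integral_cos_int_mul (by norm_num)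
    · exact integral_cos_mul_prodCos_eq_zero S 2 fun ε hε => by
        have h8' := eight_le_abs_octSum hS ε hε
        constructor <;> (intro h0; rw [h0] at h8'; norm_num at h8')
  have hone : ∫ φ in (0 : ℝ)..π, P φ = if S = ∅ then π else 0 := by
    split_ifs with hS
    · simp [hP, hS]
    · exact integral_prodCos_eq_zero (Finset.nonempty_iff_ne_empty.2 hS)
  -- the integrand as a combination of the five frequencies (integer form)
  have hsplit : (fun φ : ℝ => Real.sin φ ^ 2 * Real.cos ((8 : ℝ) ^ (e + 1) * φ) ^ 2 * P φ) = fun φ =>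
      (1 / 4 : ℝ) * P φ - (1 / 4 : ℝ) * (Real.cos (((2 : ℤ) : ℝ) * φ) * P φ)
        + (1 / 4 : ℝ) * (Real.cos (((2 * 8 ^ (e + 1) + 0 : ℤ) : ℝ) * φ) * P φ)
        - (1 / 8 : ℝ) * (Real.cos (((2 * 8 ^ (e + 1) + (-2) : ℤ) : ℝ) * φ) * P φ)
        - (1 / 8 : ℝ) * (Real.cos (((2 * 8 ^ (e + 1) + 2 : ℤ) : ℝ) * φ) * P φ) := by
    funext φ
    rw [sin_sq_mul_cos_sq_eq]
    have e1 : (((2 : ℤ) : ℝ)) * φ = 2 * φ := by push_cast; ring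
    have e2 : (((2 * 8 ^ (e + 1) + 0 : ℤ) : ℝ)) * φ = 2 * (8 : ℝ) ^ (e + 1) * φ := by push_cast; ring
    have e3 : (((2 * 8 ^ (e + 1) + (-2) : ℤ) : ℝ)) * φ = (2 * (8 : ℝ) ^ (e + 1) - 2) * φ := by push_cast; ring
    have e4 : (((2 * 8 ^ (e + 1) + 2 : ℤ) : ℝ)) * φ = (2 * (8 : ℝ) ^ (e + 1) + 2) * φ := by push_cast; ring
    rw [e1, e2, e3, e4]
    ring
  have i1 : IntervalIntegrable (fun φ : ℝ => (1 / 4 : ℝ) * P φ) volume 0 π := hIP.const_mul _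
  have i2 : IntervalIntegrable (fun φ : ℝ => (1 / 4 : ℝ) * (Real.cos (((2 : ℤ) : ℝ) * φ) * P φ)) volume 0 π :=
    (hI _).const_mul _
  have i3 : IntervalIntegrable (fun φ : ℝ =>
      (1 / 4 : ℝ) * (Real.cos (((2 * 8 ^ (e + 1) + 0 : ℤ) : ℝ) * φ) * P φ)) volume 0 π := (hI _).const_mul _
  have i4 : IntervalIntegrable (fun φ : ℝ =>
      (1 / 8 : ℝ) * (Real.cos (((2 * 8 ^ (e + 1) + (-2) : ℤ) : ℝ) * φ) * P φ)) volume 0 π := (hI _).const_mul _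
  have i5 : IntervalIntegrable (fun φ : ℝ =>
      (1 / 8 : ℝ) * (Real.cos (((2 * 8 ^ (e + 1) + 2 : ℤ) : ℝ) * φ) * P φ)) volume 0 π := (hI _).const_mul _
  have i12 : IntervalIntegrable (fun φ : ℝ => (1 / 4 : ℝ) * P φ
      - (1 / 4 : ℝ) * (Real.cos (((2 : ℤ) : ℝ) * φ) * P φ)) volume 0 π := i1.sub i2
  have i123 : IntervalIntegrable (fun φ : ℝ => (1 / 4 : ℝ) * P φ
      - (1 / 4 : ℝ) * (Real.cos (((2 : ℤ) : ℝ) * φ) * P φ)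
      + (1 / 4 : ℝ) * (Real.cos (((2 * 8 ^ (e + 1) + 0 : ℤ) : ℝ) * φ) * P φ)) volume 0 π := i12.add i3
  have i1234 : IntervalIntegrable (fun φ : ℝ => (1 / 4 : ℝ) * P φ
      - (1 / 4 : ℝ) * (Real.cos (((2 : ℤ) : ℝ) * φ) * P φ)
      + (1 / 4 : ℝ) * (Real.cos (((2 * 8 ^ (e + 1) + 0 : ℤ) : ℝ) * φ) * P φ)
      - (1 / 8 : ℝ) * (Real.cos (((2 * 8 ^ (e + 1) + (-2) : ℤ) : ℝ) * φ) * P φ)) volume 0 π := i123.sub i4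
  show ∫ φ in (0 : ℝ)..π, Real.sin φ ^ 2 * Real.cos ((8 : ℝ) ^ (e + 1) * φ) ^ 2 * P φ = _
  rw [hsplit, intervalIntegral.integral_sub i1234 i5, intervalIntegral.integral_sub i123 i4,
    intervalIntegral.integral_add i12 i3, intervalIntegral.integral_sub i1 i2]
  simp only [intervalIntegral.integral_const_mul, hone, htwo, hfreq 0 (by norm_num), hfreq (-2) (by norm_num),
    hfreq 2 (by norm_num)]
  split_ifs <;> ring

/-- ★ (d′) THE PAYMENT INTEGRAL AGAINST THE RIESZ DENSITY: for `e ∉ A`,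
`∫_0^π sin²φ·cos²(8^{e+1}φ)·ρ_A(φ)dφ = π∕4` (only the empty sub-product pays). [folklore] -/
theorem integral_sin_sq_mul_cosOct_sq_mul_rieszDensity {A : Finset ℕ} {e : ℕ} (he : e ∉ A) :
    ∫ φ in (0 : ℝ)..π, Real.sin φ ^ 2 * Real.cos ((8 : ℝ) ^ (e + 1) * φ) ^ 2 *
      ∏ k ∈ A, (1 + Real.cos ((8 : ℝ) ^ (k + 1) * φ)) = π / 4 := by
  classical
  simp_rw [Finset.prod_one_add, Finset.mul_sum]
  have hint : ∀ S ∈ A.powerset, IntervalIntegrable (fun φ : ℝ => Real.sin φ ^ 2 * Real.cos ((8 : ℝ) ^ (e + 1) * φ) ^ 2 *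
      ∏ k ∈ S, Real.cos ((8 : ℝ) ^ (k + 1) * φ)) volume 0 π := fun S _ =>
    (((Real.continuous_sin.pow 2).mul ((Real.continuous_cos.comp (continuous_const.mul continuous_id)).pow 2)).mul
      (continuous_finsetProd _ fun _ _ =>
        Real.continuous_cos.comp (continuous_const.mul continuous_id))).intervalIntegrable _ _
  rw [intervalIntegral.integral_finsetSum hint, Finset.sum_eq_single_of_mem ∅ (Finset.empty_mem_powerset A)]
  · rw [integral_sin_sq_mul_cosOct_sq_mul_prodCos (S := ∅) (by simp), if_pos rfl]
  · intro S hS hSne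
    rw [integral_sin_sq_mul_cosOct_sq_mul_prodCos (fun h => he (Finset.mem_powerset.1 hS h)), if_neg hSne]

end Summit.QuantumFields.YangMills.Theorems.BalabanUVNodesN19OctalLacunaryDissociation
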